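/-
Copyright (c) 2026.  Released under the Apache 2.0 license of this project.
Cell decomp-a2c, lens 4 (minimal-counterexample / extremal reduction), generation 70 — the ρ₁ = 1/4 far-row family: cover and package.
-/
import Summits.AtomisticToContinuum.Crystallization.Theorems.OverbindingBudgetAffineFarLayerFloor
import Summits.AtomisticToContinuum.Crystallization.Theorems.OverbindingBudgetAffineFarLayerOuterRowsE
import Summits.AtomisticToContinuum.Crystallization.Theorems.OverbindingBudgetAffineFarLayerOuterRowsK

/-!
# The ρ₁ = 1/4 far-row family: anisotropy cuts, cell cover, and the pointwise package

For the wide jet annulus `‖y − x₀‖ ≤ 1/4` (`‖x₀‖ ≤ 1/100`) the far-row hypotheses of ★★★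
`…RadialJetFar.farCoreExcess_of_threeZoneFarMainTables` are served by the NESTED family `Option (Fin 9)`:
`none` = the tenth rows of `…FarLayerRows` (used where `‖y − x₀‖ ≤ 1/10`, remainder `4.6·10⁻⁶`), `some c` = the outer cell `c` of
`…FarLayerOuterRowsE/K` (used where `1/10 < ‖y − x₀‖ ≤ 1/4`, remainders `≤ 1.2·10⁻⁴` against a slack `≥ 5.3·10⁻⁴`).
* §1 ANISOTROPY CUTS: `y ∈ KRegion (196/121)` tested on the vector pairs `(1,1,0)`, `(1,−1,0)` gives the two linear cuts
  `3 + 2y₀ + y₂ ≤ (196/121)·3·(1 − 2y₀ + y₂)` and `3(1 − 2y₀ + y₂) ≤ (196/121)(3 + 2y₀ + y₂)`, i.e.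
  `−0.2013 + 0.1494·y₂ ≤ y₀ ≤ 0.1587 + 0.3293·y₂`.
* §2 COVER: on `‖y‖ ≤ 13/50` the cuts put `(y₀, y₂)` into one of the nine cells `C0 E1 E2 E3 E4 K1 K2 K3 K4`.
* §3 HEIGHT FLOOR on the ball of radius `13/50`: ★★ `floorQuarter_of_norm_le : ‖y‖ ≤ 13/50 → (31/50)²·detPar y ≤ detFull y`
  (margin `0.016`; elementary: the split `detFull − κ·detPar = (2/3 − κ + y₄)·detPar − B(y₁,y₃)`, `B ≤ (3/2 + |y₀| + |y₂|)(y₁² + y₃²)`,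
  the norm budget `y₁² + y₃² ≤ R² − y₄² − y₀² − y₂²`, and an exact linear certificate for the remaining three-variable inequality
  whose one-variable core `(656/1875 + e − e²)² ≤ (19/10)(3e²/2 + 3e/4 + 1103/10⁴)` on `|e| ≤ 13/50` is again a linear certificate).
* §4 PACKAGE: the `Option (Fin 9)` families `quarterRow₂/₅`, their `FarRow` bundles (`farRow_quarterRow₂/₅`), and
  ★★ `farQuarter_pointwise`: for `y ∈ KRegion (196/121)`, `‖x₀‖ ≤ 1/100`, `‖y − x₀‖ ≤ 1/4` there is an index `i` with both row
  boxes, the floor `quarterδ i²·detPar y ≤ detFull y`, and the zone information (`i = none ↔` inner tenth) — NO residual hypothesis.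
  So at `ρ₁ = 1/4` too the far side of Z2 reduces to the jet inequalities ALONE (inner: remainder of the tenth rows; ring: the worst
  outer-cell remainder).
Complete proofs, axioms standard.  Tags: [formal bookkeeping] (§1, §2, §4), [elementary estimate] (§3).
-/

open Summit.AtomisticToContinuum.Crystallization.Theorems.OverbindingBudgetAffineFarSmoothSplit
open Summit.AtomisticToContinuum.Crystallization.Theorems.OverbindingBudgetAffineRadialChart
open Summit.AtomisticToContinuum.Crystallization.Theorems.OverbindingBudgetAffineFarLayerMain
open Summit.AtomisticToContinuum.Crystallization.Theorems.OverbindingBudgetAffineFarLayerRows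
open Summit.AtomisticToContinuum.Crystallization.Theorems.OverbindingBudgetAffineFarLayerFloor
open Summit.AtomisticToContinuum.Crystallization.Theorems.OverbindingBudgetAffineFarLayerOuterRowsE
open Summit.AtomisticToContinuum.Crystallization.Theorems.OverbindingBudgetAffineFarLayerOuterRowsK

namespace Summit.AtomisticToContinuum.Crystallization.Theorems.OverbindingBudgetAffineFarLayerOuterCover

/-! ## §1 Anisotropy cuts from `KRegion (196/121)` -/

/-- ★ Upper cut: testing the anisotropy cap on `n = (1,1,0)`, `m = (1,−1,0)`. [this file] -/
theorem kRegion_cut_hi {y : EuclideanSpace ℝ (Fin 5)} (hK : y ∈ KRegion (196 / 121)) :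
    (3 + 2 * y 0 + y 2) * 1 ≤ 196 / 121 * ((1 - 2 * y 0 + y 2) * 3) := by
  simp only [KRegion, Set.mem_setOf_eq] at hK
  have h := hK ![1, 1, 0] ![1, -1, 0]
  simp [chartForm_eq_affine, refForm, chartFormLin, Fin.sum_univ_five] at h
  linarith

/-- ★ Lower cut: the same pair swapped. [this file] -/
theorem kRegion_cut_lo {y : EuclideanSpace ℝ (Fin 5)} (hK : y ∈ KRegion (196 / 121)) :
    (1 - 2 * y 0 + y 2) * 3 ≤ 196 / 121 * ((3 + 2 * y 0 + y 2) * 1) := by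
  simp only [KRegion, Set.mem_setOf_eq] at hK
  have h := hK ![1, -1, 0] ![1, 1, 0]
  simp [chartForm_eq_affine, refForm, chartFormLin, Fin.sum_univ_five] at h
  linarith

/-! ## §2 The nine-cell cover of the admissible part of the disc of radius `13/50` -/

/-- The cell boxes in chart coordinates, `c : Fin 9` = `C0 E1 E2 E3 E4 K1 K2 K3 K4`: `y₀`-range and `y₂`-range. -/
def cellBox (c : Fin 9) (y : EuclideanSpace ℝ (Fin 5)) : Prop :=
  match c with
  | 0 => (-(9 / 100) ≤ y 0 ∧ y 0 ≤ 9 / 100) ∧ (-(9 / 100) ≤ y 2 ∧ y 2 ≤ 9 / 100)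
  | 1 => (9 / 100 ≤ y 0 ∧ y 0 ≤ 19 / 100) ∧ (-(9 / 100) ≤ y 2 ∧ y 2 ≤ 9 / 100)
  | 2 => (-(11 / 50) ≤ y 0 ∧ y 0 ≤ -(9 / 100)) ∧ (-(9 / 100) ≤ y 2 ∧ y 2 ≤ 9 / 100)
  | 3 => (-(9 / 100) ≤ y 0 ∧ y 0 ≤ 9 / 100) ∧ (9 / 100 ≤ y 2 ∧ y 2 ≤ 53 / 200)
  | 4 => (-(9 / 100) ≤ y 0 ∧ y 0 ≤ 9 / 100) ∧ (-(53 / 200) ≤ y 2 ∧ y 2 ≤ -(9 / 100))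
  | 5 => (9 / 100 ≤ y 0 ∧ y 0 ≤ 49 / 200) ∧ (9 / 100 ≤ y 2 ∧ y 2 ≤ 53 / 200)
  | 6 => (-(49 / 200) ≤ y 0 ∧ y 0 ≤ -(9 / 100)) ∧ (-(53 / 200) ≤ y 2 ∧ y 2 ≤ -(9 / 100))
  | 7 => (9 / 100 ≤ y 0 ∧ y 0 ≤ 13 / 100) ∧ (-(21 / 100) ≤ y 2 ∧ y 2 ≤ -(9 / 100))
  | 8 => (-(19 / 100) ≤ y 0 ∧ y 0 ≤ -(9 / 100)) ∧ (9 / 100 ≤ y 2 ∧ y 2 ≤ 53 / 200)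

/-- ★★ COVER: the anisotropy cuts and `‖y‖ ≤ 13/50` put `(y₀, y₂)` into one of the nine cells. [this file] -/
theorem exists_cellBox {y : EuclideanSpace ℝ (Fin 5)} (hK : y ∈ KRegion (196 / 121)) (hy : ‖y‖ ≤ 13 / 50) :
    ∃ c : Fin 9, cellBox c y := by
  have hhi := kRegion_cut_hi hK
  have hlo := kRegion_cut_lo hK
  have h0 := abs_le.1 ((abs_apply_le_norm y 0).trans hy)
  have h2 := abs_le.1 ((abs_apply_le_norm y 2).trans hy)
  rcases le_or_gt (y 0) (-(9 / 100)) with ha | ha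
  · rcases le_or_gt (y 2) (-(9 / 100)) with hb | hb
    · exact ⟨6, ⟨by linarith, ha⟩, ⟨by linarith, hb⟩⟩
    rcases le_or_gt (y 2) (9 / 100) with hc | hc
    · exact ⟨2, ⟨by linarith, ha⟩, ⟨hb.le, hc⟩⟩
    · exact ⟨8, ⟨by linarith, ha⟩, ⟨hc.le, by linarith⟩⟩
  rcases le_or_gt (y 0) (9 / 100) with ha' | ha'
  · rcases le_or_gt (y 2) (-(9 / 100)) with hb | hb
    · exact ⟨4, ⟨ha.le, ha'⟩, ⟨by linarith, hb⟩⟩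
    rcases le_or_gt (y 2) (9 / 100) with hc | hc
    · exact ⟨0, ⟨ha.le, ha'⟩, ⟨hb.le, hc⟩⟩
    · exact ⟨3, ⟨ha.le, ha'⟩, ⟨hc.le, by linarith⟩⟩
  · rcases le_or_gt (y 2) (-(9 / 100)) with hb | hb
    · exact ⟨7, ⟨ha'.le, by linarith⟩, ⟨by linarith, hb⟩⟩
    rcases le_or_gt (y 2) (9 / 100) with hc | hc
    · exact ⟨1, ⟨ha'.le, by linarith⟩, ⟨hb.le, hc⟩⟩
    · exact ⟨5, ⟨ha'.le, by linarith⟩, ⟨hc.le, by linarith⟩⟩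

/-! ## §3 The height floor on the ball of radius `13/50` -/

/-- ★★ HEIGHT FLOOR on the ball of radius `13/50`: `(31/50)²·detPar y ≤ detFull y` (true margin `0.016`, attained near
`y ≈ (.02, −.07, −.01, .07, −.24)` where the `(y₁, y₃)`-bracket and the `y₄`-lever trade off).  Elementary: split, bracket bound,
norm budget, then two exact linear certificates over the listed squares and products. [this file] -/
theorem floorQuarter_of_norm_le {y : EuclideanSpace ℝ (Fin 5)} (hy : ‖y‖ ≤ 13 / 50) :
    961 / 2500 * detPar y ≤ detFull y := by
  have h0 := abs_le.1 ((abs_apply_le_norm y 0).trans hy)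
  have h4 := abs_le.1 ((abs_apply_le_norm y 4).trans hy)
  have hn : ‖y‖ ^ 2 ≤ (13 / 50) ^ 2 := pow_le_pow_left₀ (norm_nonneg y) hy 2
  have hs := sum_sq_eq_norm_sq y
  set a := y 0; set b := y 1; set c := y 2; set d := y 3; set e := y 4
  have hA := abs_nonneg a
  have hC := abs_nonneg c
  have haA : a ^ 2 = |a| ^ 2 := (sq_abs a).symm
  have hcC : c ^ 2 = |c| ^ 2 := (sq_abs c).symm
  set A := |a|; set C := |c|
  -- the split `detFull − κ·detPar = (2/3 − κ + y₄)·detPar − B(y₁, y₃)`, `2/3 − 961/2500 = 2117/7500`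
  have hsplit : detFull y - 961 / 2500 * detPar y
      = (2117 / 7500 + e) * detPar y - (d ^ 2 - (1 + 2 * a) * b * d + (1 + c) * b ^ 2) := by
    unfold detFull detPar; ring
  have hK : (0 : ℝ) ≤ 2117 / 7500 + e := by linarith [h4.1]
  -- `detPar` from below in terms of `A = |y₀|`, `C = |y₂|`
  have hq : 3 / 4 - C - A - A ^ 2 ≤ detPar y := by
    have hq' : detPar y = 3 / 4 + c - a - a ^ 2 := by unfold detPar; ring
    rw [hq', haA]; linarith [neg_abs_le c, le_abs_self a]
  have hq'' : (2117 / 7500 + e) * (3 / 4 - C - A - A ^ 2) ≤ (2117 / 7500 + e) * detPar y :=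
    mul_le_mul_of_nonneg_left hq hK
  -- the bracket `B(y₁, y₃) ≤ (3/2 + A + C)(y₁² + y₃²)`
  have h1 : 0 ≤ 1 + 2 * a := by linarith [h0.1]
  have hB1 : -((1 + 2 * a) * b * d) ≤ (1 + 2 * a) * ((b ^ 2 + d ^ 2) / 2) := by
    linarith [mul_nonneg h1 (sq_nonneg (b + d))]
  have hB2 : (1 + 2 * a) * ((b ^ 2 + d ^ 2) / 2) ≤ (1 + 2 * A) * ((b ^ 2 + d ^ 2) / 2) :=
    mul_le_mul_of_nonneg_right (by linarith [le_abs_self a]) (by positivity)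
  have hB3 : (1 + c) * b ^ 2 ≤ (1 + C) * b ^ 2 :=
    mul_le_mul_of_nonneg_right (by linarith [le_abs_self c]) (sq_nonneg b)
  have hB : d ^ 2 - (1 + 2 * a) * b * d + (1 + c) * b ^ 2 ≤ (3 / 2 + A + C) * (b ^ 2 + d ^ 2) := by
    linarith [mul_nonneg hC (sq_nonneg d), mul_nonneg hA (sq_nonneg b)]
  -- the norm budget `y₁² + y₃² ≤ R² − y₄² − A² − C²`
  have hbd : b ^ 2 + d ^ 2 ≤ 169 / 2500 - e ^ 2 - A ^ 2 - C ^ 2 := by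
    rw [← haA, ← hcC]; linarith [hs, hn]
  have hB' : (3 / 2 + A + C) * (b ^ 2 + d ^ 2) ≤ (3 / 2 + A + C) * (169 / 2500 - e ^ 2 - A ^ 2 - C ^ 2) :=
    mul_le_mul_of_nonneg_left hbd (by linarith)
  -- the one-variable core (linear certificate over `e²·(2e − e² + 59/100) ≥ 0` and `(e + 37/200)² ≥ 0`)
  have h59 : 0 ≤ 2 * e - e ^ 2 + 59 / 100 := by
    linarith [mul_nonneg (show (0:ℝ) ≤ e + 13 / 50 by linarith [h4.1]) (show (0:ℝ) ≤ 113 / 50 - e by linarith [h4.2])]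
  have hP : (656 / 1875 + e - e ^ 2) ^ 2 ≤ 19 / 10 * (3 / 2 * e ^ 2 + 3 / 4 * e + 1103 / 10000) := by
    linarith [mul_nonneg (sq_nonneg e) h59, sq_nonneg (e + 37 / 200), h4.1, h4.2]
  -- the three-variable inequality `G(e, A, C) ≥ 0` (exact linear certificate: `10/19`, `19/40`, `1`, `1`, `11/20`, `10/19`)
  have h55 : (0 : ℝ) ≤ 11 / 20 - 2117 / 7500 - e := by linarith [h4.2]
  have hG : 0 ≤ (2117 / 7500 + e) * (3 / 4 - C - A - A ^ 2) - (3 / 2 + A + C) * (169 / 2500 - e ^ 2 - A ^ 2 - C ^ 2) := by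
    linarith [hP, sq_nonneg (19 / 20 * (A + C) - (656 / 1875 + e - e ^ 2)), sq_nonneg (A - C),
      mul_nonneg (add_nonneg hA hC) (add_nonneg (sq_nonneg A) (sq_nonneg C)), mul_nonneg h55 (sq_nonneg A), sq_nonneg C]
  linarith [hsplit, hq'', hB, hB', hG]

/-! ## §4 The families and the pointwise package -/

/-- The outer `μ = 2` rows by cell. -/
def outerRow₂ : Fin 9 → DualRow :=
  ![outCellC0Mu2, outCellE1Mu2, outCellE2Mu2, outCellE3Mu2, outCellE4Mu2, outCellK1Mu2, outCellK2Mu2, outCellK3Mu2, outCellK4Mu2]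

/-- The outer `μ = 5` rows by cell. -/
def outerRow₅ : Fin 9 → DualRow :=
  ![outCellC0Mu5, outCellE1Mu5, outCellE2Mu5, outCellE3Mu5, outCellE4Mu5, outCellK1Mu5, outCellK2Mu5, outCellK3Mu5, outCellK4Mu5]

/-- The rational ratio ceiling of the outer bundles. -/
noncomputable def outerQ : ℝ :=
  1 / (1 + 6 * (((31 / 50 : ℚ) : ℝ) * ((33 / 50 : ℚ) : ℝ)) + 18 * (((31 / 50 : ℚ) : ℝ) * ((33 / 50 : ℚ) : ℝ)) ^ 2)

/-- The rational ratio ceiling of the tenth bundles. -/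
noncomputable def tenthQ : ℝ :=
  1 / (1 + 6 * (((37 / 50 : ℚ) : ℝ) * ((11 / 16 : ℚ) : ℝ)) + 18 * (((37 / 50 : ℚ) : ℝ) * ((11 / 16 : ℚ) : ℝ)) ^ 2)

/-- ★ Every outer `μ = 2` row is a far row of index `3`. [this file] -/
theorem farRow_outerRow₂ (c : Fin 9) : FarRow (outerRow₂ c) 3 ((31 / 50 : ℚ) : ℝ) (33 / 50) outerQ := by
  fin_cases c
  exacts [farRow_outCellC0Mu2, farRow_outCellE1Mu2, farRow_outCellE2Mu2, farRow_outCellE3Mu2, farRow_outCellE4Mu2,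
    farRow_outCellK1Mu2, farRow_outCellK2Mu2, farRow_outCellK3Mu2, farRow_outCellK4Mu2]

/-- ★ Every outer `μ = 5` row is a far row of index `6`. [this file] -/
theorem farRow_outerRow₅ (c : Fin 9) : FarRow (outerRow₅ c) 6 ((31 / 50 : ℚ) : ℝ) (33 / 50) outerQ := by
  fin_cases c
  exacts [farRow_outCellC0Mu5, farRow_outCellE1Mu5, farRow_outCellE2Mu5, farRow_outCellE3Mu5, farRow_outCellE4Mu5,
    farRow_outCellK1Mu5, farRow_outCellK2Mu5, farRow_outCellK3Mu5, farRow_outCellK4Mu5]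

/-- ★ A cell box gives both row boxes of that cell. [this file] -/
theorem inRowBox_outer {c : Fin 9} {y : EuclideanSpace ℝ (Fin 5)} (h : cellBox c y) :
    InRowBox (outerRow₂ c) y ∧ InRowBox (outerRow₅ c) y := by
  fin_cases c
  exacts [inRowBox_outCellC0 h.1 h.2, inRowBox_outCellE1 h.1 h.2, inRowBox_outCellE2 h.1 h.2, inRowBox_outCellE3 h.1 h.2,
    inRowBox_outCellE4 h.1 h.2, inRowBox_outCellK1 h.1 h.2, inRowBox_outCellK2 h.1 h.2, inRowBox_outCellK3 h.1 h.2,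
    inRowBox_outCellK4 h.1 h.2]

/-- The nested `ρ₁ = 1/4` family, `μ = 2`: `none` = tenth row, `some c` = outer cell `c`. -/
def quarterRow₂ : Option (Fin 9) → DualRow
  | none => annRowTenthMu2
  | some c => outerRow₂ c

/-- The nested `ρ₁ = 1/4` family, `μ = 5`. -/
def quarterRow₅ : Option (Fin 9) → DualRow
  | none => annRowTenthMu5
  | some c => outerRow₅ c

/-- Height floors of the nested family. -/
noncomputable def quarterδ : Option (Fin 9) → ℝ
  | none => ((37 / 50 : ℚ) : ℝ)
  | some _ => ((31 / 50 : ℚ) : ℝ)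

/-- Bundle radii of the nested family. -/
def quarterR₀ : Option (Fin 9) → ℚ
  | none => 11 / 16
  | some _ => 33 / 50

/-- Ratio ceilings of the nested family. -/
noncomputable def quarterQ : Option (Fin 9) → ℝ
  | none => tenthQ
  | some _ => outerQ

/-- ★ The `hrow₂` hypothesis of ★★★ `…FarMainTables` for the nested family. [this file] -/
theorem farRow_quarterRow₂ (i : Option (Fin 9)) : FarRow (quarterRow₂ i) 3 (quarterδ i) (quarterR₀ i) (quarterQ i) := by
  cases i with
  | none => exact farRow_annRowTenthMu2
  | some c => exact farRow_outerRow₂ c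

/-- ★ The `hrow₅` hypothesis of ★★★ `…FarMainTables` for the nested family. [this file] -/
theorem farRow_quarterRow₅ (i : Option (Fin 9)) : FarRow (quarterRow₅ i) 6 (quarterδ i) (quarterR₀ i) (quarterQ i) := by
  cases i with
  | none => exact farRow_annRowTenthMu5
  | some c => exact farRow_outerRow₅ c

/-- ★ From the wide annulus to the ball of radius `13/50`. -/
theorem norm_le_of_quarter {x₀ y : EuclideanSpace ℝ (Fin 5)} (hx₀ : ‖x₀‖ ≤ 1 / 100) (h : ‖y - x₀‖ ≤ 1 / 4) :
    ‖y‖ ≤ 13 / 50 := by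
  have := norm_le_norm_add_norm_sub' y x₀
  linarith [norm_sub_rev y x₀]

/-- ★★ THE ρ₁ = 1/4 FAR-SIDE POINTWISE PACKAGE: for `y ∈ KRegion (196/121)`, `‖x₀‖ ≤ 1/100`, `‖y − x₀‖ ≤ 1/4` some member of the
nested family has both row boxes and its height floor at `y`; the index is `none` (tenth rows, small remainder) exactly when
`‖y − x₀‖ ≤ 1/10`.  With `κ₂ = κ₅ = Option (Fin 9)`, `R₂ w = quarterRow₂`, `R₅ w = quarterRow₅`, `δ w = quarterδ` these are the
non-jet conjuncts of the `hmaj`/`hmin` bodies of ★★★ `…RadialJetFar.farCoreExcess_of_threeZoneFarMainTables`, and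
`farRow_quarterRow₂/₅` are its `hrow₂`/`hrow₅` — leaving ONLY the jet inequalities to certify. [this file] -/
theorem farQuarter_pointwise
    {x₀ y : EuclideanSpace ℝ (Fin 5)} (hK : y ∈ KRegion (196 / 121)) (hx₀ : ‖x₀‖ ≤ 1 / 100) (h : ‖y - x₀‖ ≤ 1 / 4) :
    ∃ i : Option (Fin 9), InRowBox (quarterRow₂ i) y ∧ InRowBox (quarterRow₅ i) y ∧ quarterδ i ^ 2 * detPar y ≤ detFull y ∧
      (i = none ↔ ‖y - x₀‖ ≤ 1 / 10) := by
  by_cases hin : ‖y - x₀‖ ≤ 1 / 10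
  · obtain ⟨h₂, h₅, hf⟩ := farTenth_pointwise hx₀ hin
    exact ⟨none, h₂, h₅, hf, ⟨fun _ => hin, fun _ => rfl⟩⟩
  · have hy := norm_le_of_quarter hx₀ h
    obtain ⟨c, hc⟩ := exists_cellBox hK hy
    obtain ⟨h₂, h₅⟩ := inRowBox_outer hc
    have hf := floorQuarter_of_norm_le hy
    have hf' : ((31 / 50 : ℚ) : ℝ) ^ 2 * detPar y ≤ detFull y := by push_cast; linarith [hf]
    exact ⟨some c, h₂, h₅, hf', ⟨fun h' => (Option.some_ne_none c h').elim, fun h' => (hin h').elim⟩⟩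

end Summit.AtomisticToContinuum.Crystallization.Theorems.OverbindingBudgetAffineFarLayerOuterCover
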